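import Summits.QuantumFields.YangMills.Theorems.BalabanUVNodesN15PerCubeGreenSummandRowOfUnitary
import Summits.QuantumFields.YangMills.Theorems.BalabanUVNodesN15PerCubeGreenTwoGridEntryThreeAlgebra
import Summits.QuantumFields.YangMills.Theorems.BalabanUVNodesN15PerCubeGreenCutGramTwoGridDefect
import Summits.QuantumFields.YangMills.Theorems.BalabanUVNodesN15PerCubeGreenTwoGridNonlocalRow
import Summits.QuantumFields.YangMills.Theorems.BalabanUVNodesN15PerCubeGreenTwoGridCutRows
import Summits.QuantumFields.YangMills.Theorems.BalabanUVNodesN15CurvedGluingLocalGaugesTwoGridTwisted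
import Summits.QuantumFields.YangMills.Theorems.BalabanUVNodesN15CovariantTwoGridPullbackTwistData
import Summits.QuantumFields.YangMills.Theorems.BalabanUVNodesN15NeumannCubeDefect
import HarnessLib

/-!
# N15 = NE2, road (c) — PROGRAMME (PC), TOWARDS ENTRY 3 OF (3.42): THE TWO-GRID η-DEFECT OF ONE CUBE's PIECE `M_{h′_k}·P′·M_{χ′_k}` OF BAŁABAN's COVARIANT AVERAGING SUMMAND
# THROUGH THE COVARIANT TRANSPORT `τ_S` — n15-c∕376's located row `𝔇_{τ_S}(P′,P)` PER CUBE, from the cube-gauge letters on the plateau blocks (dag-n15-c g34, n15-c∕378)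

Cell `pub-ymgap`, seat `pub-ymgap-dag-n15-c` (generation g34; R134 (a) seat, strategy s1 «first missing estimate»; HUMAN RULING D-0062; chair R424 venue).
`bears_on: R4∕N15 · K3⁸ SpineGivenEndpointR13SepCoPHV (stmt-QuantumFields-27366)`; filed `--kind proof --supports stmt-QuantumFields-27366 --as helper` — COUNT-NEUTRAL.
ONE theorem, 0 `def`, 0 `sorry`.  Imports BY NAME n15-c∕377 (`hasMaj_scP_of_unitary`, `hasMaj_scP'_of_unitary`), n15-c∕376, n15-c∕352 `…CutGramTwoGridDefect` (`hasMaj_idef_scNV_pairing`),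
n15-c `…TwoGridNonlocalRow` (`hasMaj_idef_pull_scQQ_king`), `…TwoGridCutRows` (`scChi'_eq_scChi_kingPr`, `scBlk_kingPr_mem_cvSk_of_scChi'_ne_zero` ∕ `…scPsi'…`, `mulOp_scH'_comp_mulOp_scPsi'`),
n15-c∕333 `…CurvedGluingLocalGaugesTwoGridTwisted` (`cutDefect_of_localGauge_tr`, `pull_comp_mulOp_fst`, `mulOp_fst_comp_mmulOp_smul`, `mmulOp_comp_mulOp_fst_smul`), n15-c∕336
`…CovariantTwoGridPullbackTwistData` (`ctauS_eq_conj_gaugeT`, `smear_cols_kingStairT_transpose_sub_one_le(_kingPr)`), n15-a `…NeumannCubeDefect` (`hasMaj_mulOp_comp_of_abs_le_one`).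
Nothing in the tree is modified, no landed name re-declared.

WHY (n15-c∕376's docstring; HOME memo `EVIDENCE-N15C-G34-HOLDER-NATIVE.md` §4).  Entry 3 of (3.42) at two spacings reduces (n15-c∕376 `hasMaj_idef_entryThree`) to the entry-0 row, the
decay of `G`, a bound on `P′` (n15-c∕377) and ONE new row: the two-grid defect `𝔇_{τ_S}(P′, P)` of Bałaban's summand `P = a·Q′_T(U)ᵀQ′_T(U)` through the covariant transport `τ_S` of
the (PC-E) chain.  `P` is block-diagonal and `Σ_k M_{h_k} = 1`, `χ_kh_k = h_k`, so `P = Σ_k M_{h_k}PM_{χ_k}` (cubes `k`); THIS FILE bounds the defect of ONE such piece by dag-n15-w2's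
per-piece conversion n15-c∕333 `cutDefect_of_localGauge_tr`: in the cube gauge `u′_k` (unitary everywhere), `M_{h′}P′M_{χ′} = M_{h′}·M_{W′ᵀ}(P′(V′)M_{χ′})M_{W′}` with `V′ = u′U′u′(·+e′)ᴴ`
(gauge covariance n15-c `scP'_gauge`), `τ_S = M_{W′ᵀ}(M_{S_Vᵀ}P̂)M_{W′∘σ}` (n15-c∕336 `ctauS_eq_conj_gaugeT`), and in that gauge `P′(V′) = a′Q₁′ᵀQ₁′ − N′_V k` (definition of `scNV′`), so the
FLAT defect of the gauged piece is n15-c `hasMaj_idef_pull_scQQ_king` minus n15-c∕352 `hasMaj_idef_scNV_pairing` (both in the tree), the pieces' rows are n15-c∕377 (any unitary field),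
and the smeared stair letters come from the pointwise letter `ρ` on the plateau blocks (n15-c∕336).
* ★★★ `hasMaj_idef_ctauS_scP_piece` — for unitary cube gauges `u′`, a unitary fine bond field `U′`, the coarse field = straight fine holonomies, and the letters `‖V′ − 1‖ ≤ ρ`,
  `‖V′_μ(z+e′_κ) − V′_μ(z)‖ ≤ b` of the gauged fine field on the blocks of `𝔅_k`: the piece defect `𝔇_{τ_S}(M_{h′_k}P′M_{χ′_k}, M_{h_k}PM_{χ_k}) ≤ |ι|²(m + 2s·a₀|ι|²)·e^{−δd}`, `m` = the
  flat constant (`4a₀∕3·(L^k)^{−2} + o_N` of 352), `s = (1 + |ι|κ_e2√m√mρ)^{(d+1)(L^r−1)} − 1` — `O(L^{−2k}) + O(ηp) + O(ηq)`, uniform in the cube.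

HONEST FRAMING ∕ LIMITS.  Bookkeeping over landed rows in the MODEL two-grid setting (King tori, straight-holonomy pairing, one cube scale); the letters are the (3.35) letters in the cube
gauges (produced per cube from the datum by n15-c∕346∕360∕370); nothing of [B9] asserted ((3.19) p.393, (3.24) p.394, (3.32) p.395 = SHAPES).  The SUM over cubes (`P = Σ_k M_{h_k}PM_{χ_k}`,
`|K| = (2L)^{d+1}` classes) and the instantiation of n15-c∕376 are NOT here.  NE2⁺ NOT PRINTED ∕ NOT proved; N15 of record untouched (DISCHARGED AS CONSUMED, p687738); K3⁸ OPEN; counts of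
record UNMOVED (typed 28∕28 · discharged 8∕27); one finite 𝕋⁴ at fixed ε per index — NOT infinite volume, NOT OS on ℝ⁴, NOT a mass gap, NOT Clay.  Restate-immune (no Theses import).
-/

set_option autoImplicit false

noncomputable section

open scoped BigOperators Matrix Matrix.Norms.L2Operator
open Finset

namespace Summit.QuantumFields.YangMills.BalabanUVNodes.N15.Gluing

open Real
open Literature.MathematicalPhysics.QuantumFieldTheory.Balaban1983to89
open Literature.MathematicalPhysics.QuantumFieldTheory.Balaban1983to89.B5Prop11Plancherel (Tor fine unitVec)
open Literature.MathematicalPhysics.QuantumFieldTheory.Balaban1983to89.B11SectG (BlockNorm HasMaj)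
open Literature.MathematicalPhysics.QuantumFieldTheory.Balaban1983to89.T4EtaRateDefect (idef idef_sub idef_comp)
open Literature.MathematicalPhysics.QuantumFieldTheory.Balaban1983to89.T4EtaRateCoeffDefect (diagK diagK_same diagK_ne diagK_nonneg)
open Literature.MathematicalPhysics.QuantumFieldTheory.Balaban1983to89.T4EtaRateCoeffDefect (pull)
open Literature.MathematicalPhysics.QuantumFieldTheory.Balaban1983to89.B6Prop26Gluing (mulOp ind ind_of_mem ind_nonneg)
open Literature.MathematicalPhysics.QuantumFieldTheory.Balaban1983to89.B6UnitTorusCarrier (unitTorusGeo)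
open Literature.MathematicalPhysics.QuantumFieldTheory.King1986 (aK aK_pos aK_le)
open Literature.Barriers.QuantumFields (traceForm)
open Summit.QuantumFields.YangMills.BalabanUVNodes.N15.VectorPiece (kingPr)
open Summit.QuantumFields.YangMills.BalabanUVNodes.N15.MatrixSpecies (mmulOp mmulOp_comp_mmulOp coordMat basisConst basisConst_nonneg liftBlk liftMap)
open Summit.QuantumFields.YangMills.BalabanUVNodes.N15.CurvedSpecies (cutDefect_of_localGauge_tr hasMaj_idef_mulOp_tr pull_comp_mulOp_fst mulOp_fst_comp_mmulOp_smul mmulOp_comp_mulOp_fst_smul mmulOp_one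
  uN_coordMat_conj_orthogonal uN_gaugeTransformed_bond_unitary uN_abs_coordMat_conj_sub_one_entry_le_op)
open Summit.QuantumFields.YangMills.BalabanUVNodes.N15.CovLandau (gaugeT)
open Summit.QuantumFields.YangMills.BalabanUVNodes.N15.CovAvg (mprod kingSec ctauS kingStairT ctauS_eq_conj_gaugeT smear_cols_kingStairT_transpose_sub_one_le
  smear_cols_kingStairT_transpose_sub_one_le_kingPr conjTranspose_mprod_mul_self blockOf_kingPr)
open Summit.QuantumFields.YangMills.BalabanUVNodes.N15.TwoGrid (hasMaj_mulOp_comp_of_abs_le_one abs_chiCube_le_one)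

variable {d : ℕ} {L : ℕ} [NeZero L] {mv kk r : ℕ} {hL : Odd L ∧ 1 < L} {mm : Type} [Fintype mm] [DecidableEq mm] [Nonempty mm] (ι : Type) [Fintype ι] [DecidableEq ι]
  (e : Matrix mm mm ℂ ≃L[ℝ] (ι → ℝ))

variable (hM : ∀ ν, cvM d L mv kk hL ν = 2 * L * L ^ mv) (hm₁ : 2 * L ^ mv ≤ coverMargin L mv) (hfitI : coverMargin L mv - 2 * L ^ mv + (6 * L ^ mv + 1) ≤ L * L ^ mv)
  (hS0 : L * L ^ mv ≤ 2 * L * L ^ mv) (hw : 0 < L ^ mv)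

include hM hm₁ hfitI hS0 hw in
set_option maxHeartbeats 1600000 in
/-- ★★★ **THE TWO-GRID η-DEFECT OF ONE CUBE's PIECE OF THE COVARIANT AVERAGING SUMMAND THROUGH `τ_S`** — see the module docstring. [cite: Balaban1985BackgroundPropagators, (3.19) p.393,
(3.24) p.394, (3.32)–(3.35) pp.395–396, (3.62)–(3.65) pp.402–403 (shapes ∕ mechanism); Balaban1984PropagatorsII, (2.133) p.247; King1986, p.664 (pairing convention)] -/
theorem hasMaj_idef_ctauS_scP_piece (hL2 : (2 : ℝ) ≤ (L : ℝ)) (hkk : 1 ≤ kk) (he : ∀ A B : Matrix mm mm ℂ, traceForm A B = e A ⬝ᵥ e B) {a₀ : ℝ} (ha₀ : 0 < a₀)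
    (u' : (Fin (d + 1) → ZMod (2 * L)) → ScX' d L mv kk r hL → Matrix mm mm ℂ) (hu' : ∀ k z, (u' k z)ᴴ * u' k z = 1)
    (U' : Fin (d + 1) → ScX' d L mv kk r hL → Matrix mm mm ℂ) (hU' : ∀ μ z, (U' μ z)ᴴ * U' μ z = 1) (U : Fin (d + 1) → ScX d L mv kk hL → Matrix mm mm ℂ)
    (hpair : ∀ μ y, U μ y = mprod (fun t => U' μ (kingSec (cvM d L mv kk hL) L kk r y + t • unitVec (fine (L ^ r * L ^ kk) (cvM d L mv kk hL)) μ)) (L ^ r))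
    {ρ b : ℝ} (hρ : 0 ≤ ρ) (hb : 0 ≤ b)
    (hρk : ∀ k μ (z : ScX' d L mv kk r hL), scBlk' d L mv kk r hL z ∈ cvSk d L mv kk hL k → ‖u' k z * U' μ z * (u' k (scShift' d L mv kk r hL μ z))ᴴ - 1‖ ≤ ρ)
    (hbk : ∀ k κ μ (z : ScX' d L mv kk r hL), scBlk' d L mv kk r hL z ∈ cvSk d L mv kk hL k →
      ‖u' k (z + unitVec (fine (L ^ r * L ^ kk) (cvM d L mv kk hL)) κ) * U' μ (z + unitVec (fine (L ^ r * L ^ kk) (cvM d L mv kk hL)) κ) * (u' k ((z + unitVec (fine (L ^ r * L ^ kk) (cvM d L mv kk hL)) κ) + unitVec (fine (L ^ r * L ^ kk) (cvM d L mv kk hL)) μ))ᴴ - (u' k z * U' μ z * (u' k (z + unitVec (fine (L ^ r * L ^ kk) (cvM d L mv kk hL)) μ))ᴴ)‖ ≤ b)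
    {δ : ℝ} (hδ : 0 ≤ δ) (k : Fin (d + 1) → ZMod (2 * L))
    -- the cut algebra of the cover on the fine sites: `M_χ′M_h′ = M_h′` (dag-n15-w3 52's `hχh`, n15-c∕339's `hχhf`)
    (hχh : mulOp (fun p : ScX d L mv kk hL × ι => scChi d L mv kk hL k p.1) ∘ₗ mulOp (fun p : ScX d L mv kk hL × ι => scH d L mv kk hL k p.1) = mulOp (fun p : ScX d L mv kk hL × ι => scH d L mv kk hL k p.1))
    (hχh' : mulOp (fun p : ScX' d L mv kk r hL × ι => scChi' d L mv kk r hL k p.1) ∘ₗ mulOp (fun p : ScX' d L mv kk r hL × ι => scH' d L mv kk r hL k p.1) = mulOp (fun p : ScX' d L mv kk r hL × ι => scH' d L mv kk r hL k p.1)) :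
    HasMaj (ScNorm d L mv kk hL ι) (BlockNorm.ofBlocks (unitTorusGeo L kk (cvM d L mv kk hL)) (liftBlk (scBlk d L mv kk hL ∘ kingPr L kk r (cvM d L mv kk hL)) ι))
      (idef (ctauS (cvM d L mv kk hL) L kk r (cvT e U')) (ctauS (cvM d L mv kk hL) L kk r (cvT e U'))
        (mulOp (fun p : ScX' d L mv kk r hL × ι => scPsi' d L mv kk r hL k p.1) ∘ₗ (scP' d L mv kk r hL (aK a₀ (L : ℝ) (r + kk) * (((L ^ r * L ^ kk : ℕ) : ℝ)) ^ (d + 1)) ι e U' ∘ₗ mulOp (fun p : ScX' d L mv kk r hL × ι => scH' d L mv kk r hL k p.1)))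
        (mulOp (fun p : ScX d L mv kk hL × ι => scPsi d L mv kk hL k p.1) ∘ₗ (scP d L mv kk hL (aK a₀ (L : ℝ) kk * (((L ^ kk : ℕ) : ℝ)) ^ (d + 1)) ι e U ∘ₗ mulOp (fun p : ScX d L mv kk hL × ι => scH d L mv kk hL k p.1))))
      (fun y y' => (Fintype.card ι : ℝ) ^ 2 * (((4 / 3 * a₀ * ((L : ℝ) ^ kk) ^ (-(2 : ℝ))) + (Fintype.card ι * (|aK a₀ (L : ℝ) (r + kk) - aK a₀ (L : ℝ) kk| * (1 + Fintype.card ι) + |aK a₀ (L : ℝ) kk| * (2 * Fintype.card ι * (@basisConst ι _ (Matrix mm mm ℂ) Matrix.frobeniusNormedAddCommGroup Matrix.frobeniusNormedSpace e * (2 * Real.sqrt (Fintype.card mm)) * (Real.sqrt (Fintype.card mm) * ((d + 1) * (d * ((((L ^ r * L ^ kk : ℕ) : ℝ)) * (((L ^ r : ℕ) : ℝ) * b)) + ((1 + ρ) ^ (L ^ r) - 1)))))))) + (a₀ * (Fintype.card ι : ℝ) ^ 2 * (Fintype.card ι * (Real.pi * (d + 1) / (((L ^ kk : ℕ) : ℝ)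 * ((L ^ mv : ℕ) : ℝ)))))) + ((1 + (Fintype.card ι * (@basisConst ι _ (Matrix mm mm ℂ) Matrix.frobeniusNormedAddCommGroup Matrix.frobeniusNormedSpace e * (2 * Real.sqrt (Fintype.card mm)) * (Real.sqrt (Fintype.card mm) * ρ)))) ^ ((d + 1) * (L ^ r - 1)) - 1) * (a₀ * (Fintype.card ι : ℝ) ^ 2) + ((1 + (Fintype.card ι * (@basisConst ι _ (Matrix mm mm ℂ) Matrix.frobeniusNormedAddCommGroup Matrix.frobeniusNormedSpace e * (2 * Real.sqrt (Fintype.card mm)) * (Real.sqrt (Fintype.card mm) * ρ)))) ^ ((d + 1) * (L ^ r - 1)) - 1) * (a₀ * (Fintype.card ι : ℝ) ^ 2)) * Real.exp (-(δ * (unitTorusGeo L kk (cvM d L mv kk hL)).dist y y'))) := by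
  classical
  -- numerics
  have hLpos : 0 < L := Nat.pos_of_ne_zero (NeZero.ne L)
  have hL1 : (1 : ℝ) < (L : ℝ) := by exact_mod_cast hL.2
  have hLr : 0 < L ^ r := pow_pos hLpos r
  have hrk : 1 ≤ r + kk := le_add_left hkk
  have hnc0 : (0 : ℝ) < ((L ^ kk : ℕ) : ℝ) := by exact_mod_cast pow_pos hLpos kk
  have hnf0 : (0 : ℝ) < ((L ^ r * L ^ kk : ℕ) : ℝ) := by exact_mod_cast Nat.mul_pos hLr (pow_pos hLpos kk)
  have hw0 : (0 : ℝ) < ((L ^ mv : ℕ) : ℝ) := by exact_mod_cast hw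
  have hκ := @basisConst_nonneg ι _ (Matrix mm mm ℂ) Matrix.frobeniusNormedAddCommGroup Matrix.frobeniusNormedSpace e
  have hι0 : (0 : ℝ) ≤ Fintype.card ι := Nat.cast_nonneg _
  have haK : 0 < aK a₀ (L : ℝ) kk := aK_pos ha₀ hL1 hkk
  have haK' : 0 < aK a₀ (L : ℝ) (r + kk) := aK_pos ha₀ hL1 hrk
  have haKle : aK a₀ (L : ℝ) kk ≤ a₀ := aK_le ha₀ hL1 hkk
  have haKle' : aK a₀ (L : ℝ) (r + kk) ≤ a₀ := aK_le ha₀ hL1 hrk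
  have hρ1 : (0 : ℝ) ≤ (Fintype.card ι * (@basisConst ι _ (Matrix mm mm ℂ) Matrix.frobeniusNormedAddCommGroup Matrix.frobeniusNormedSpace e * (2 * Real.sqrt (Fintype.card mm)) * (Real.sqrt (Fintype.card mm) * ρ))) := by positivity
  have hs0 : (0 : ℝ) ≤ ((1 + (Fintype.card ι * (@basisConst ι _ (Matrix mm mm ℂ) Matrix.frobeniusNormedAddCommGroup Matrix.frobeniusNormedSpace e * (2 * Real.sqrt (Fintype.card mm)) * (Real.sqrt (Fintype.card mm) * ρ)))) ^ ((d + 1) * (L ^ r - 1)) - 1) := by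
    have := one_le_pow₀ (M₀ := ℝ) (a := 1 + (Fintype.card ι * (@basisConst ι _ (Matrix mm mm ℂ) Matrix.frobeniusNormedAddCommGroup Matrix.frobeniusNormedSpace e * (2 * Real.sqrt (Fintype.card mm)) * (Real.sqrt (Fintype.card mm) * ρ)))) (le_add_of_nonneg_right hρ1) (n := (d + 1) * (L ^ r - 1)); linarith
  have hβ0 : (0 : ℝ) ≤ (a₀ * (Fintype.card ι : ℝ) ^ 2) := by positivity
  have hON0 : (0 : ℝ) ≤ (Fintype.card ι * (|aK a₀ (L : ℝ) (r + kk) - aK a₀ (L : ℝ) kk| * (1 + Fintype.card ι) + |aK a₀ (L : ℝ) kk| * (2 * Fintype.card ι * (@basisConst ι _ (Matrix mm mm ℂ) Matrix.frobeniusNormedAddCommGroup Matrix.frobeniusNormedSpace e * (2 * Real.sqrt (Fintype.card mm)) * (Real.sqrt (Fintype.card mm) * ((d + 1) * (d * ((((L ^ r * L ^ kk : ℕ) : ℝ)) * (((L ^ r : ℕ) : ℝ) * b)) + ((1 + ρ) ^ (L ^ r) - 1)))))))) := by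
    have : (0 : ℝ) ≤ (1 + ρ) ^ (L ^ r) - 1 := by have := one_le_pow₀ (M₀ := ℝ) (a := 1 + ρ) (le_add_of_nonneg_right hρ) (n := L ^ r); linarith
    positivity
  have hMQ0 : (0 : ℝ) ≤ (4 / 3 * a₀ * ((L : ℝ) ^ kk) ^ (-(2 : ℝ))) := by positivity
  have hOH0 : (0 : ℝ) ≤ (a₀ * (Fintype.card ι : ℝ) ^ 2 * (Fintype.card ι * (Real.pi * (d + 1) / (((L ^ kk : ℕ) : ℝ) * ((L ^ mv : ℕ) : ℝ))))) := by positivity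
  have hm0 : (0 : ℝ) ≤ ((4 / 3 * a₀ * ((L : ℝ) ^ kk) ^ (-(2 : ℝ))) + (Fintype.card ι * (|aK a₀ (L : ℝ) (r + kk) - aK a₀ (L : ℝ) kk| * (1 + Fintype.card ι) + |aK a₀ (L : ℝ) kk| * (2 * Fintype.card ι * (@basisConst ι _ (Matrix mm mm ℂ) Matrix.frobeniusNormedAddCommGroup Matrix.frobeniusNormedSpace e * (2 * Real.sqrt (Fintype.card mm)) * (Real.sqrt (Fintype.card mm) * ((d + 1) * (d * ((((L ^ r * L ^ kk : ℕ) : ℝ)) * (((L ^ r : ℕ) : ℝ) * b)) + ((1 + ρ) ^ (L ^ r) - 1)))))))) + (a₀ * (Fintype.card ι : ℝ) ^ 2 * (Fintype.card ι * (Real.pi * (d + 1) / (((L ^ kk : ℕ) : ℝ) * ((L ^ mv : ℕ) : ℝ)))))) := by positivity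
  -- the cube gauge in colour coordinates: orthogonal both sides
  set W' : (Fin (d + 1) → ZMod (2 * L)) → ScX' d L mv kk r hL → Matrix ι ι ℝ := fun k x' => coordMat e (ContinuousLinearMap.mulLeftRight ℝ (Matrix mm mm ℂ) (u' k x') (u' k x')ᴴ) with hW'def
  have hW'1 : ∀ k v, (W' k v)ᵀ * W' k v = 1 := fun k v => (uN_coordMat_conj_orthogonal e he (hu' k v)).1
  have hW'2 : ∀ k v, W' k v * (W' k v)ᵀ = 1 := fun k v => (uN_coordMat_conj_orthogonal e he (hu' k v)).2
  -- the coarse field and the gauged fields are unitary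
  have hU : ∀ μ y, (U μ y)ᴴ * U μ y = 1 := fun μ y => by rw [hpair μ y]; exact conjTranspose_mprod_mul_self fun t _ => hU' μ _
  have hV'u : ∀ μ z, ((scGaugeU' d L mv kk r hL (u' k) U') μ z)ᴴ * (scGaugeU' d L mv kk r hL (u' k) U') μ z = 1 := fun μ z => uN_gaugeTransformed_bond_unitary (scShift' d L mv kk r hL) (u' k) U' (hu' k) hU' μ z
  have hVu : ∀ μ x, ((scGaugeU d L mv kk hL (fun x => u' k (kingSec (cvM d L mv kk hL) L kk r x)) U) μ x)ᴴ * (scGaugeU d L mv kk hL (fun x => u' k (kingSec (cvM d L mv kk hL) L kk r x)) U) μ x = 1 := fun μ x =>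
    uN_gaugeTransformed_bond_unitary (scShift d L mv kk hL) (fun x => u' k (kingSec (cvM d L mv kk hL) L kk r x)) U (fun x => hu' k _) hU μ x
  -- the staircase field of the gauged fine datum and the transport identity (n15-c∕336)
  set St : (Fin (d + 1) → ZMod (2 * L)) → ScX' d L mv kk r hL → Matrix ι ι ℝ := fun k x' =>
    kingStairT (cvM d L mv kk hL) (L ^ r * L ^ kk) (L ^ r) (fun μ b => gaugeT (cvM d L mv kk hL) (L ^ r * L ^ kk) (W' k) (cvT e U') μ b.1) (x', (0 : Fin (d + 1))) with hStdef
  have hTk : ctauS (cvM d L mv kk hL) L kk r (cvT e U') = mmulOp (fun x' => (W' k x')ᵀ) ∘ₗ (mmulOp (fun x' => (St k x')ᵀ) ∘ₗ pull (liftMap (kingPr L kk r (cvM d L mv kk hL)) ι)) ∘ₗ mmulOp (fun x => W' k (kingSec (cvM d L mv kk hL) L kk r x)) :=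
    ctauS_eq_conj_gaugeT (cvM d L mv kk hL) L kk r (hW'1 k) (cvT e U')
  have hgT : gaugeT (cvM d L mv kk hL) (L ^ r * L ^ kk) (W' k) (cvT e U') = cvT e (scGaugeU' d L mv kk r hL (u' k) U') := (cvT_scGaugeU' (d := d) (L := L) (ι := ι) e he (hu' k) U').symm
  -- cut algebra
  have hχidem : mulOp (fun p : ScX' d L mv kk r hL × ι => scChi' d L mv kk r hL k p.1) ∘ₗ mulOp (fun p : ScX' d L mv kk r hL × ι => scChi' d L mv kk r hL k p.1) = mulOp (fun p : ScX' d L mv kk r hL × ι => scChi' d L mv kk r hL k p.1) := mulOp_comp_mulOp_of_support_left fun _ hp => chiCube_eq_one_of_ne_zero hp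
  have hψidem : mulOp (fun p : ScX d L mv kk hL × ι => scPsi d L mv kk hL k p.1) ∘ₗ mulOp (fun p : ScX d L mv kk hL × ι => scPsi d L mv kk hL k p.1) = mulOp (fun p : ScX d L mv kk hL × ι => scPsi d L mv kk hL k p.1) := mulOp_comp_mulOp_of_support_left fun _ hp => chiCube_eq_one_of_ne_zero hp
  have hhχ' : mulOp (fun p : ScX' d L mv kk r hL × ι => scH' d L mv kk r hL k p.1) ∘ₗ mulOp (fun p : ScX' d L mv kk r hL × ι => scChi' d L mv kk r hL k p.1) = mulOp (fun p : ScX' d L mv kk r hL × ι => scH' d L mv kk r hL k p.1) := by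
    rw [mulOp_comp_mulOp, mul_comm, ← mulOp_comp_mulOp]; exact hχh' 
  have hψpull : pull (liftMap (kingPr L kk r (cvM d L mv kk hL)) ι) ∘ₗ mulOp (fun p : ScX d L mv kk hL × ι => scPsi d L mv kk hL k p.1) = mulOp (fun p : ScX' d L mv kk r hL × ι => scPsi' d L mv kk r hL k p.1) ∘ₗ pull (liftMap (kingPr L kk r (cvM d L mv kk hL)) ι) := (mulOp_scPsi'_comp_pull (d := d) (hL := hL) ι k).symm
  -- (1) the gauged pieces, their supports
  have hGin' : (scP' d L mv kk r hL (aK a₀ (L : ℝ) (r + kk) * (((L ^ r * L ^ kk : ℕ) : ℝ)) ^ (d + 1)) ι e (scGaugeU' d L mv kk r hL (u' k) U') ∘ₗ mulOp (fun p : ScX' d L mv kk r hL × ι => scH' d L mv kk r hL k p.1)) ∘ₗ mulOp (fun p : ScX' d L mv kk r hL × ι => scChi' d L mv kk r hL k p.1) = scP' d L mv kk r hL (aK a₀ (L : ℝ) (r + kk) * (((L ^ r * L ^ kk : ℕ) : ℝ)) ^ (d + 1)) ι e (scGaugeU' d L mv kk r hL (u' k) U') ∘ₗ mulOp (fun p :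 ScX' d L mv kk r hL × ι => scH' d L mv kk r hL k p.1) := by rw [LinearMap.comp_assoc, hhχ']
  have hGout : mulOp (fun p : ScX d L mv kk hL × ι => scPsi d L mv kk hL k p.1) ∘ₗ (mulOp (fun p : ScX d L mv kk hL × ι => scPsi d L mv kk hL k p.1) ∘ₗ (scP d L mv kk hL (aK a₀ (L : ℝ) kk * (((L ^ kk : ℕ) : ℝ)) ^ (d + 1)) ι e (scGaugeU d L mv kk hL (fun x => u' k (kingSec (cvM d L mv kk hL) L kk r x)) U) ∘ₗ mulOp (fun p : ScX d L mv kk hL × ι => scH d L mv kk hL k p.1))) = mulOp (fun p : ScX d L mv kk hL × ι => scPsi d L mv kk hL k p.1) ∘ₗ (scP d L mv kk hL (aK a₀ (L : ℝ) kk * (((L ^ kk : ℕ) : ℝ)) ^ (d + 1)) ι e (scGaugeU d L mv kk hL (fun x => u' k (kingSec (cvM d L mv kk hL) L kk r x)) U) ∘ₗ mulOp (fun p : ScX d L mv kk hL × ι => scH d L mv kk hL k p.1)) := by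
    rw [← LinearMap.comp_assoc, hψidem]
  -- (2) the smeared stair letters from the pointwise letter `ρ` on the plateau blocks (n15-c∕336)
  have hTcol : ∀ μ (y' : ScX' d L mv kk r hL), Literature.MathematicalPhysics.QuantumFieldTheory.King1986.Torus.blockOf (L ^ r * L ^ kk) (cvM d L mv kk hL) y' ∈ cvSk d L mv kk hL k →
      ∀ j, ∑ i, |(gaugeT (cvM d L mv kk hL) (L ^ r * L ^ kk) (W' k) (cvT e U') μ y' - 1) i j| ≤ (Fintype.card ι * (@basisConst ι _ (Matrix mm mm ℂ) Matrix.frobeniusNormedAddCommGroup Matrix.frobeniusNormedSpace e * (2 * Real.sqrt (Fintype.card mm)) * (Real.sqrt (Fintype.card mm) * ρ))) := by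
    intro μ y' hy' j
    rw [hgT]
    have hn : ‖(scGaugeU' d L mv kk r hL (u' k) U') μ y' - 1‖ ≤ ρ := hρk k μ y' hy'
    calc ∑ i, |(cvT e (scGaugeU' d L mv kk r hL (u' k) U') μ y' - 1) i j| ≤ ∑ _i : ι, @basisConst ι _ (Matrix mm mm ℂ) Matrix.frobeniusNormedAddCommGroup Matrix.frobeniusNormedSpace e * (2 * Real.sqrt (Fintype.card mm)) * (Real.sqrt (Fintype.card mm) * ρ) :=
          Finset.sum_le_sum fun i _ => (uN_abs_coordMat_conj_sub_one_entry_le_op e (hV'u μ y') i j).trans (by gcongr)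
      _ = (Fintype.card ι * (@basisConst ι _ (Matrix mm mm ℂ) Matrix.frobeniusNormedAddCommGroup Matrix.frobeniusNormedSpace e * (2 * Real.sqrt (Fintype.card mm)) * (Real.sqrt (Fintype.card mm) * ρ))) := by rw [Finset.sum_const, Finset.card_univ, nsmul_eq_mul]
  have hSin : ∀ (x' : ScX' d L mv kk r hL) i, ∑ j, |(scChi' d L mv kk r hL k x' • ((St k x')ᵀ - 1)) i j| ≤ ((1 + (Fintype.card ι * (@basisConst ι _ (Matrix mm mm ℂ) Matrix.frobeniusNormedAddCommGroup Matrix.frobeniusNormedSpace e * (2 * Real.sqrt (Fintype.card mm)) * (Real.sqrt (Fintype.card mm) * ρ)))) ^ ((d + 1) * (L ^ r - 1)) - 1) := fun x' i =>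
    smear_cols_kingStairT_transpose_sub_one_le (cvM d L mv kk hL) L kk r hLr hρ1 (cvSk d L mv kk hL k) hTcol (ψ := fun x' => scChi' d L mv kk r hL k x') (fun x' => abs_chiCube_le_one _ _)
      (fun x' hx => by rw [← blockOf_kingPr (cvM d L mv kk hL) L kk r x']; exact scBlk_kingPr_mem_cvSk_of_scChi'_ne_zero hM hm₁ hfitI hS0 hx) x' i
  have hSout : ∀ (x' : ScX' d L mv kk r hL) i, ∑ j, |(scPsi d L mv kk hL k (kingPr L kk r (cvM d L mv kk hL) x') • ((St k x')ᵀ - 1)) i j| ≤ ((1 + (Fintype.card ι * (@basisConst ι _ (Matrix mm mm ℂ) Matrix.frobeniusNormedAddCommGroup Matrix.frobeniusNormedSpace e * (2 * Real.sqrt (Fintype.card mm)) * (Real.sqrt (Fintype.card mm) * ρ)))) ^ ((d + 1) * (L ^ r - 1)) - 1) := fun x' i =>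
    smear_cols_kingStairT_transpose_sub_one_le_kingPr (cvM d L mv kk hL) L kk r hLr hρ1 (cvSk d L mv kk hL k) hTcol (ψo := fun x => scPsi d L mv kk hL k x) (fun x => abs_chiCube_le_one _ _)
      (fun x hx => scBlk_mem_cvSk_of_scPsi_ne_zero hx) x' i
  -- (3) the pieces' rows (n15-c∕377: any unitary field) with the cuts
  have hlift : liftBlk (scBlk' d L mv kk r hL) ι = liftBlk (scBlk d L mv kk hL ∘ kingPr L kk r (cvM d L mv kk hL)) ι := funext fun p => (blockOf_kingPr (cvM d L mv kk hL) L kk r p.1).symm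
  have haF : |(aK a₀ (L : ℝ) (r + kk) * (((L ^ r * L ^ kk : ℕ) : ℝ)) ^ (d + 1))| * ((((L ^ r * L ^ kk : ℕ) : ℝ)) ^ (d + 1))⁻¹ = aK a₀ (L : ℝ) (r + kk) := by
    rw [abs_of_pos (by positivity), mul_assoc, mul_inv_cancel₀ (by positivity), mul_one]
  have haC : |(aK a₀ (L : ℝ) kk * (((L ^ kk : ℕ) : ℝ)) ^ (d + 1))| * ((((L ^ kk : ℕ) : ℝ)) ^ (d + 1))⁻¹ = aK a₀ (L : ℝ) kk := by
    rw [abs_of_pos (by positivity), mul_assoc, mul_inv_cancel₀ (by positivity), mul_one]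
  have hPV'row : HasMaj (BlockNorm.ofBlocks (unitTorusGeo L kk (cvM d L mv kk hL)) (liftBlk (scBlk d L mv kk hL ∘ kingPr L kk r (cvM d L mv kk hL)) ι)) (BlockNorm.ofBlocks (unitTorusGeo L kk (cvM d L mv kk hL)) (liftBlk (scBlk d L mv kk hL ∘ kingPr L kk r (cvM d L mv kk hL)) ι)) (scP' d L mv kk r hL (aK a₀ (L : ℝ) (r + kk) * (((L ^ r * L ^ kk : ℕ) : ℝ)) ^ (d + 1)) ι e (scGaugeU' d L mv kk r hL (u' k) U')) (fun y y' => (a₀ * (Fintype.card ι : ℝ) ^ 2) * Real.exp (-(δ * (unitTorusGeo L kk (cvM d L mv kk hL)).dist y y'))) := by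
    have h := hasMaj_scP'_of_unitary (d := d) ι e he hV'u (aK a₀ (L : ℝ) (r + kk) * (((L ^ r * L ^ kk : ℕ) : ℝ)) ^ (d + 1)) δ
    rw [show ScNorm' d L mv kk r hL ι = BlockNorm.ofBlocks (unitTorusGeo L kk (cvM d L mv kk hL)) (liftBlk (scBlk d L mv kk hL ∘ kingPr L kk r (cvM d L mv kk hL)) ι) from congrArg (BlockNorm.ofBlocks (unitTorusGeo L kk (cvM d L mv kk hL))) hlift] at h
    refine h.mono fun y y' => ?_
    rw [haF]
    have : aK a₀ (L : ℝ) (r + kk) * (Fintype.card ι : ℝ) ^ 2 ≤ a₀ * (Fintype.card ι : ℝ) ^ 2 := by gcongr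
    exact mul_le_mul_of_nonneg_right this (Real.exp_nonneg _)
  have hPVrow : HasMaj (ScNorm d L mv kk hL ι) (ScNorm d L mv kk hL ι) (scP d L mv kk hL (aK a₀ (L : ℝ) kk * (((L ^ kk : ℕ) : ℝ)) ^ (d + 1)) ι e (scGaugeU d L mv kk hL (fun x => u' k (kingSec (cvM d L mv kk hL) L kk r x)) U)) (fun y y' => (a₀ * (Fintype.card ι : ℝ) ^ 2) * Real.exp (-(δ * (unitTorusGeo L kk (cvM d L mv kk hL)).dist y y'))) := by
    have h := hasMaj_scP_of_unitary (d := d) ι e he hVu (aK a₀ (L : ℝ) kk * (((L ^ kk : ℕ) : ℝ)) ^ (d + 1)) δ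
    refine h.mono fun y y' => ?_
    rw [haC]
    have : aK a₀ (L : ℝ) kk * (Fintype.card ι : ℝ) ^ 2 ≤ a₀ * (Fintype.card ι : ℝ) ^ 2 := by gcongr
    exact mul_le_mul_of_nonneg_right this (Real.exp_nonneg _)
  have hEXP0 : ∀ y y' : Tor (cvM d L mv kk hL), (0 : ℝ) ≤ (a₀ * (Fintype.card ι : ℝ) ^ 2) * Real.exp (-(δ * (unitTorusGeo L kk (cvM d L mv kk hL)).dist y y')) := fun y y' => by positivity
  have hind : ∀ y : Tor (cvM d L mv kk hL), ind (g := unitTorusGeo L kk (cvM d L mv kk hL)) (Set.univ : Set (Tor (cvM d L mv kk hL))) y = 1 := fun y => ind_of_mem (g := unitTorusGeo L kk (cvM d L mv kk hL)) (Set.mem_univ y)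
  have hh1le : ∀ p : ScX' d L mv kk r hL × ι, |(fun p : ScX' d L mv kk r hL × ι => scH' d L mv kk r hL k p.1) p| ≤ 1 := fun p => abs_hcube_le_one (2 * L) (scXi' d L mv kk r hL) k p.1
  have hhle : ∀ p : ScX d L mv kk hL × ι, |(fun p : ScX d L mv kk hL × ι => scH d L mv kk hL k p.1) p| ≤ 1 := fun p => abs_hcube_le_one (2 * L) (scXi d L mv kk hL) k p.1
  have hψ1le : ∀ p : ScX' d L mv kk r hL × ι, |(fun p : ScX' d L mv kk r hL × ι => scPsi' d L mv kk r hL k p.1) p| ≤ 1 := fun p => abs_chiCube_le_one _ _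
  have hψle : ∀ p : ScX d L mv kk hL × ι, |(fun p : ScX d L mv kk hL × ι => scPsi d L mv kk hL k p.1) p| ≤ 1 := fun p => abs_chiCube_le_one _ _
  have hGc' : HasMaj (BlockNorm.ofBlocks (unitTorusGeo L kk (cvM d L mv kk hL)) (liftBlk (scBlk d L mv kk hL ∘ kingPr L kk r (cvM d L mv kk hL)) ι)) (BlockNorm.ofBlocks (unitTorusGeo L kk (cvM d L mv kk hL)) (liftBlk (scBlk d L mv kk hL ∘ kingPr L kk r (cvM d L mv kk hL)) ι)) (mulOp (fun p : ScX' d L mv kk r hL × ι => scPsi' d L mv kk r hL k p.1) ∘ₗ (scP' d L mv kk r hL (aK a₀ (L : ℝ) (r + kk) * (((L ^ r * L ^ kk : ℕ) : ℝ)) ^ (d + 1)) ι e (scGaugeU' d L mv kk r hL (u' k) U') ∘ₗ mulOp (fun p : ScX' d L mv kk r hL × ι => scH' d L mv kk r hL k p.1)))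
      (fun y y' => ind (g := unitTorusGeo L kk (cvM d L mv kk hL)) (Set.univ : Set (Tor (cvM d L mv kk hL))) y * ind (g := unitTorusGeo L kk (cvM d L mv kk hL)) (Set.univ : Set (Tor (cvM d L mv kk hL))) y' * ((a₀ * (Fintype.card ι : ℝ) ^ 2) * Real.exp (-(δ * (unitTorusGeo L kk (cvM d L mv kk hL)).dist y y')))) := by
    have h1 := hasMaj_comp_mulOp_cut (b₂ := BlockNorm.ofBlocks (unitTorusGeo L kk (cvM d L mv kk hL)) (liftBlk (scBlk d L mv kk hL ∘ kingPr L kk r (cvM d L mv kk hL)) ι)) (liftBlk (scBlk d L mv kk hL ∘ kingPr L kk r (cvM d L mv kk hL)) ι) hEXP0 (χ := (fun p : ScX' d L mv kk r hL × ι => scH' d L mv kk r hL k p.1)) (S := (Set.univ : Set (Tor (cvM d L mv kk hL)))) hh1le (fun _ _ => Set.mem_univ _) hPV'row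
    have h2 := hasMaj_mulOp_comp_of_abs_le_one (liftBlk (scBlk d L mv kk hL ∘ kingPr L kk r (cvM d L mv kk hL)) ι) (m := (fun p : ScX' d L mv kk r hL × ι => scPsi' d L mv kk r hL k p.1)) hψ1le (fun y y' => show (0 : ℝ) ≤ ind (g := unitTorusGeo L kk (cvM d L mv kk hL)) (Set.univ : Set (Tor (cvM d L mv kk hL))) y' * ((a₀ * (Fintype.card ι : ℝ) ^ 2) * Real.exp (-(δ * (unitTorusGeo L kk (cvM d L mv kk hL)).dist y y'))) from mul_nonneg (ind_nonneg (g := unitTorusGeo L kk (cvM d L mv kk hL)) Set.univ y') (hEXP0 y y')) h1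
    refine h2.mono fun y y' => ?_
    rw [hind, hind]; ring_nf; exact le_rfl
  have hGc : HasMaj (ScNorm d L mv kk hL ι) (ScNorm d L mv kk hL ι) (mulOp (fun p : ScX d L mv kk hL × ι => scPsi d L mv kk hL k p.1) ∘ₗ (scP d L mv kk hL (aK a₀ (L : ℝ) kk * (((L ^ kk : ℕ) : ℝ)) ^ (d + 1)) ι e (scGaugeU d L mv kk hL (fun x => u' k (kingSec (cvM d L mv kk hL) L kk r x)) U) ∘ₗ mulOp (fun p : ScX d L mv kk hL × ι => scH d L mv kk hL k p.1)))
      (fun y y' => ind (g := unitTorusGeo L kk (cvM d L mv kk hL)) (Set.univ : Set (Tor (cvM d L mv kk hL))) y * ind (g := unitTorusGeo L kk (cvM d L mv kk hL)) (Set.univ : Set (Tor (cvM d L mv kk hL))) y' * ((a₀ * (Fintype.card ι : ℝ) ^ 2) * Real.exp (-(δ * (unitTorusGeo L kk (cvM d L mv kk hL)).dist y y')))) := by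
    have h1 := hasMaj_comp_mulOp_cut (b₂ := ScNorm d L mv kk hL ι) (liftBlk (scBlk d L mv kk hL) ι) hEXP0 (χ := (fun p : ScX d L mv kk hL × ι => scH d L mv kk hL k p.1)) (S := (Set.univ : Set (Tor (cvM d L mv kk hL)))) hhle (fun _ _ => Set.mem_univ _) hPVrow
    have h2 := hasMaj_mulOp_comp_of_abs_le_one (liftBlk (scBlk d L mv kk hL) ι) (m := (fun p : ScX d L mv kk hL × ι => scPsi d L mv kk hL k p.1)) hψle (fun y y' => show (0 : ℝ) ≤ ind (g := unitTorusGeo L kk (cvM d L mv kk hL)) (Set.univ : Set (Tor (cvM d L mv kk hL))) y' * ((a₀ * (Fintype.card ι : ℝ) ^ 2) * Real.exp (-(δ * (unitTorusGeo L kk (cvM d L mv kk hL)).dist y y'))) from mul_nonneg (ind_nonneg (g := unitTorusGeo L kk (cvM d L mv kk hL)) Set.univ y') (hEXP0 y y')) h1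
    refine h2.mono fun y y' => ?_
    rw [hind, hind]; ring_nf; exact le_rfl
  -- (4) the flat defect of the gauged pieces: partition fit + flat nonlocal row − 352's cut Gram row
  have hPV' : scP' d L mv kk r hL (aK a₀ (L : ℝ) (r + kk) * (((L ^ r * L ^ kk : ℕ) : ℝ)) ^ (d + 1)) ι e (scGaugeU' d L mv kk r hL (u' k) U') = scQQ' d L mv kk r hL (aK a₀ (L : ℝ) (r + kk) * (((L ^ r * L ^ kk : ℕ) : ℝ)) ^ (d + 1)) ι - scNV' d L mv kk r hL (aK a₀ (L : ℝ) (r + kk) * (((L ^ r * L ^ kk : ℕ) : ℝ)) ^ (d + 1)) ι e u' U' k := by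
    have e1 : scNV' d L mv kk r hL (aK a₀ (L : ℝ) (r + kk) * (((L ^ r * L ^ kk : ℕ) : ℝ)) ^ (d + 1)) ι e u' U' k = scQQ' d L mv kk r hL (aK a₀ (L : ℝ) (r + kk) * (((L ^ r * L ^ kk : ℕ) : ℝ)) ^ (d + 1)) ι - scP' d L mv kk r hL (aK a₀ (L : ℝ) (r + kk) * (((L ^ r * L ^ kk : ℕ) : ℝ)) ^ (d + 1)) ι e (scGaugeU' d L mv kk r hL (u' k) U') := by
      rw [← scP'_gauge (d := d) ι e he (aK a₀ (L : ℝ) (r + kk) * (((L ^ r * L ^ kk : ℕ) : ℝ)) ^ (d + 1)) (hu' k) U']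
      rfl
    rw [e1]; abel
  have hPV : scP d L mv kk hL (aK a₀ (L : ℝ) kk * (((L ^ kk : ℕ) : ℝ)) ^ (d + 1)) ι e (scGaugeU d L mv kk hL (fun x => u' k (kingSec (cvM d L mv kk hL) L kk r x)) U) = scQQ d L mv kk hL (aK a₀ (L : ℝ) kk * (((L ^ kk : ℕ) : ℝ)) ^ (d + 1)) ι - scNV d L mv kk hL (aK a₀ (L : ℝ) kk * (((L ^ kk : ℕ) : ℝ)) ^ (d + 1)) ι e (fun k x => u' k (kingSec (cvM d L mv kk hL) L kk r x)) U k := by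
    have e1 : scNV d L mv kk hL (aK a₀ (L : ℝ) kk * (((L ^ kk : ℕ) : ℝ)) ^ (d + 1)) ι e (fun k x => u' k (kingSec (cvM d L mv kk hL) L kk r x)) U k = scQQ d L mv kk hL (aK a₀ (L : ℝ) kk * (((L ^ kk : ℕ) : ℝ)) ^ (d + 1)) ι - scP d L mv kk hL (aK a₀ (L : ℝ) kk * (((L ^ kk : ℕ) : ℝ)) ^ (d + 1)) ι e (scGaugeU d L mv kk hL (fun x => u' k (kingSec (cvM d L mv kk hL) L kk r x)) U) := by
      rw [← scP_gauge (d := d) ι e he (aK a₀ (L : ℝ) kk * (((L ^ kk : ℕ) : ℝ)) ^ (d + 1)) (w := fun x => u' k (kingSec (cvM d L mv kk hL) L kk r x)) (fun x => hu' k _) U]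
      rfl
    rw [e1]; abel
  have hχpull : pull (liftMap (kingPr L kk r (cvM d L mv kk hL)) ι) ∘ₗ mulOp (fun p : ScX d L mv kk hL × ι => scChi d L mv kk hL k p.1) = mulOp (fun p : ScX' d L mv kk r hL × ι => scChi' d L mv kk r hL k p.1) ∘ₗ pull (liftMap (kingPr L kk r (cvM d L mv kk hL)) ι) := pull_comp_mulOp_scChi (d := d) (hL := hL) ι k
  have hPid : idef (pull (liftMap (kingPr L kk r (cvM d L mv kk hL)) ι)) (pull (liftMap (kingPr L kk r (cvM d L mv kk hL)) ι)) (scP' d L mv kk r hL (aK a₀ (L : ℝ) (r + kk) * (((L ^ r * L ^ kk : ℕ) : ℝ)) ^ (d + 1)) ι e (scGaugeU' d L mv kk r hL (u' k) U')) (scP d L mv kk hL (aK a₀ (L : ℝ) kk * (((L ^ kk : ℕ) : ℝ)) ^ (d + 1)) ι e (scGaugeU d L mv kk hL (fun x => u' k (kingSec (cvM d L mv kk hL) L kk r x)) U)) = idef (pull (liftMap (kingPr L kk r (cvM d L mv kk hL)) ι)) (pull (liftMap (kingPr L kk r (cvM d L mv kk hL)) ι)) (scQQ' d L mv kk r hL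 (aK a₀ (L : ℝ) (r + kk) * (((L ^ r * L ^ kk : ℕ) : ℝ)) ^ (d + 1)) ι) (scQQ d L mv kk hL (aK a₀ (L : ℝ) kk * (((L ^ kk : ℕ) : ℝ)) ^ (d + 1)) ι) - idef (pull (liftMap (kingPr L kk r (cvM d L mv kk hL)) ι)) (pull (liftMap (kingPr L kk r (cvM d L mv kk hL)) ι)) (scNV' d L mv kk r hL (aK a₀ (L : ℝ) (r + kk) * (((L ^ r * L ^ kk : ℕ) : ℝ)) ^ (d + 1)) ι e u' U' k) (scNV d L mv kk hL (aK a₀ (L : ℝ) kk * (((L ^ kk : ℕ) : ℝ)) ^ (d + 1)) ι e (fun k x => u' k (kingSec (cvM d L mv kk hL) L kk r x)) U k) := by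
    rw [hPV', hPV, idef_sub]
  have eN : mulOp (fun p : ScX' d L mv kk r hL × ι => scPsi' d L mv kk r hL k p.1) ∘ₗ (idef (pull (liftMap (kingPr L kk r (cvM d L mv kk hL)) ι)) (pull (liftMap (kingPr L kk r (cvM d L mv kk hL)) ι)) (scNV' d L mv kk r hL (aK a₀ (L : ℝ) (r + kk) * (((L ^ r * L ^ kk : ℕ) : ℝ)) ^ (d + 1)) ι e u' U' k) (scNV d L mv kk hL (aK a₀ (L : ℝ) kk * (((L ^ kk : ℕ) : ℝ)) ^ (d + 1)) ι e (fun k x => u' k (kingSec (cvM d L mv kk hL) L kk r x)) U k) ∘ₗ mulOp (fun p : ScX d L mv kk hL × ι => scH d L mv kk hL k p.1)) = idef (pull (liftMap (kingPr L kk r (cvM d L mv kk hL)) ι)) (pull (liftMap (kingPr L kk r (cvM d L mv kk hL)) ι)) (mulOp (fun p : ScX' d L mv kk r hL × ι => scPsi' d L mv kk r hL k p.1) ∘ₗ (scNV' d L mv kk r hL (aK a₀ (L : ℝ) (r + kk) * (((L ^ r * L ^ kk : ℕ) : ℝ)) ^ (d + 1)) ι e u' U' k) ∘ₗ mulOp (fun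 p : ScX' d L mv kk r hL × ι => scChi' d L mv kk r hL k p.1)) (mulOp (fun p : ScX d L mv kk hL × ι => scPsi d L mv kk hL k p.1) ∘ₗ (scNV d L mv kk hL (aK a₀ (L : ℝ) kk * (((L ^ kk : ℕ) : ℝ)) ^ (d + 1)) ι e (fun k x => u' k (kingSec (cvM d L mv kk hL) L kk r x)) U k) ∘ₗ mulOp (fun p : ScX d L mv kk hL × ι => scChi d L mv kk hL k p.1)) ∘ₗ mulOp (fun p : ScX d L mv kk hL × ι => scH d L mv kk hL k p.1) := by
    have s1 : idef (pull (liftMap (kingPr L kk r (cvM d L mv kk hL)) ι)) (pull (liftMap (kingPr L kk r (cvM d L mv kk hL)) ι)) (scNV' d L mv kk r hL (aK a₀ (L : ℝ) (r + kk) * (((L ^ r * L ^ kk : ℕ) : ℝ)) ^ (d + 1)) ι e u' U' k) (scNV d L mv kk hL (aK a₀ (L : ℝ) kk * (((L ^ kk : ℕ) : ℝ)) ^ (d + 1)) ι e (fun k x => u' k (kingSec (cvM d L mv kk hL) L kk r x)) U k) ∘ₗ mulOp (fun p : ScX d L mv kk hL × ι => scChi d L mv kk hL k p.1) = idef (pull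 (liftMap (kingPr L kk r (cvM d L mv kk hL)) ι)) (pull (liftMap (kingPr L kk r (cvM d L mv kk hL)) ι)) ((scNV' d L mv kk r hL (aK a₀ (L : ℝ) (r + kk) * (((L ^ r * L ^ kk : ℕ) : ℝ)) ^ (d + 1)) ι e u' U' k) ∘ₗ mulOp (fun p : ScX' d L mv kk r hL × ι => scChi' d L mv kk r hL k p.1)) ((scNV d L mv kk hL (aK a₀ (L : ℝ) kk * (((L ^ kk : ℕ) : ℝ)) ^ (d + 1)) ι e (fun k x => u' k (kingSec (cvM d L mv kk hL) L kk r x)) U k) ∘ₗ mulOp (fun p : ScX d L mv kk hL × ι => scChi d L mv kk hL k p.1)) :=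
      (idef_comp_cut (τ₁ := pull (liftMap (kingPr L kk r (cvM d L mv kk hL)) ι)) (pull (liftMap (kingPr L kk r (cvM d L mv kk hL)) ι)) (ψ := (fun p : ScX d L mv kk hL × ι => scChi d L mv kk hL k p.1)) (ψ' := (fun p : ScX' d L mv kk r hL × ι => scChi' d L mv kk r hL k p.1)) hχpull.symm (scNV' d L mv kk r hL (aK a₀ (L : ℝ) (r + kk) * (((L ^ r * L ^ kk : ℕ) : ℝ)) ^ (d + 1)) ι e u' U' k) (scNV d L mv kk hL (aK a₀ (L : ℝ) kk * (((L ^ kk : ℕ) : ℝ)) ^ (d + 1)) ι e (fun k x => u' k (kingSec (cvM d L mv kk hL) L kk r x)) U k)).symm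
    have s2 : mulOp (fun p : ScX' d L mv kk r hL × ι => scPsi' d L mv kk r hL k p.1) ∘ₗ idef (pull (liftMap (kingPr L kk r (cvM d L mv kk hL)) ι)) (pull (liftMap (kingPr L kk r (cvM d L mv kk hL)) ι)) ((scNV' d L mv kk r hL (aK a₀ (L : ℝ) (r + kk) * (((L ^ r * L ^ kk : ℕ) : ℝ)) ^ (d + 1)) ι e u' U' k) ∘ₗ mulOp (fun p : ScX' d L mv kk r hL × ι => scChi' d L mv kk r hL k p.1)) ((scNV d L mv kk hL (aK a₀ (L : ℝ) kk * (((L ^ kk : ℕ) : ℝ)) ^ (d + 1)) ι e (fun k x => u' k (kingSec (cvM d L mv kk hL) L kk r x)) U k) ∘ₗ mulOp (fun p : ScX d L mv kk hL × ι => scChi d L mv kk hL k p.1)) = idef (pull (liftMap (kingPr L kk r (cvM d L mv kk hL)) ι)) (pull (liftMap (kingPr L kk r (cvM d L mv kk hL)) ι)) (mulOp (fun p : ScX' d L mv kk r hL × ι => scPsi' d L mv kk r hL k p.1) ∘ₗ (scNV' d L mv kk r hL (aK a₀ (L : ℝ) (r + kk) * (((L ^ r * L ^ kk : ℕ) : ℝ))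 ^ (d + 1)) ι e u' U' k) ∘ₗ mulOp (fun p : ScX' d L mv kk r hL × ι => scChi' d L mv kk r hL k p.1)) (mulOp (fun p : ScX d L mv kk hL × ι => scPsi d L mv kk hL k p.1) ∘ₗ (scNV d L mv kk hL (aK a₀ (L : ℝ) kk * (((L ^ kk : ℕ) : ℝ)) ^ (d + 1)) ι e (fun k x => u' k (kingSec (cvM d L mv kk hL) L kk r x)) U k) ∘ₗ mulOp (fun p : ScX d L mv kk hL × ι => scChi d L mv kk hL k p.1)) :=
      (idef_cut_comp (τ := pull (liftMap (kingPr L kk r (cvM d L mv kk hL)) ι)) (pr := liftMap (kingPr L kk r (cvM d L mv kk hL)) ι) (hχ := hψpull) ((scNV' d L mv kk r hL (aK a₀ (L : ℝ) (r + kk) * (((L ^ r * L ^ kk : ℕ) : ℝ)) ^ (d + 1)) ι e u' U' k) ∘ₗ mulOp (fun p : ScX' d L mv kk r hL × ι => scChi' d L mv kk r hL k p.1)) ((scNV d L mv kk hL (aK a₀ (L : ℝ) kk * (((L ^ kk : ℕ) : ℝ)) ^ (d + 1)) ι e (fun k x => u' k (kingSec (cvM d L mv kk hL) L kk r x)) U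 k) ∘ₗ mulOp (fun p : ScX d L mv kk hL × ι => scChi d L mv kk hL k p.1))).symm
    calc mulOp (fun p : ScX' d L mv kk r hL × ι => scPsi' d L mv kk r hL k p.1) ∘ₗ (idef (pull (liftMap (kingPr L kk r (cvM d L mv kk hL)) ι)) (pull (liftMap (kingPr L kk r (cvM d L mv kk hL)) ι)) (scNV' d L mv kk r hL (aK a₀ (L : ℝ) (r + kk) * (((L ^ r * L ^ kk : ℕ) : ℝ)) ^ (d + 1)) ι e u' U' k) (scNV d L mv kk hL (aK a₀ (L : ℝ) kk * (((L ^ kk : ℕ) : ℝ)) ^ (d + 1)) ι e (fun k x => u' k (kingSec (cvM d L mv kk hL) L kk r x)) U k) ∘ₗ mulOp (fun p : ScX d L mv kk hL × ι => scH d L mv kk hL k p.1))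
        = mulOp (fun p : ScX' d L mv kk r hL × ι => scPsi' d L mv kk r hL k p.1) ∘ₗ (idef (pull (liftMap (kingPr L kk r (cvM d L mv kk hL)) ι)) (pull (liftMap (kingPr L kk r (cvM d L mv kk hL)) ι)) (scNV' d L mv kk r hL (aK a₀ (L : ℝ) (r + kk) * (((L ^ r * L ^ kk : ℕ) : ℝ)) ^ (d + 1)) ι e u' U' k) (scNV d L mv kk hL (aK a₀ (L : ℝ) kk * (((L ^ kk : ℕ) : ℝ)) ^ (d + 1)) ι e (fun k x => u' k (kingSec (cvM d L mv kk hL) L kk r x)) U k) ∘ₗ (mulOp (fun p : ScX d L mv kk hL × ι => scChi d L mv kk hL k p.1) ∘ₗ mulOp (fun p : ScX d L mv kk hL × ι => scH d L mv kk hL k p.1))) := by rw [hχh]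
      _ = (mulOp (fun p : ScX' d L mv kk r hL × ι => scPsi' d L mv kk r hL k p.1) ∘ₗ (idef (pull (liftMap (kingPr L kk r (cvM d L mv kk hL)) ι)) (pull (liftMap (kingPr L kk r (cvM d L mv kk hL)) ι)) (scNV' d L mv kk r hL (aK a₀ (L : ℝ) (r + kk) * (((L ^ r * L ^ kk : ℕ) : ℝ)) ^ (d + 1)) ι e u' U' k) (scNV d L mv kk hL (aK a₀ (L : ℝ) kk * (((L ^ kk : ℕ) : ℝ)) ^ (d + 1)) ι e (fun k x => u' k (kingSec (cvM d L mv kk hL) L kk r x)) U k) ∘ₗ mulOp (fun p : ScX d L mv kk hL × ι => scChi d L mv kk hL k p.1))) ∘ₗ mulOp (fun p : ScX d L mv kk hL × ι => scH d L mv kk hL k p.1) := by simp only [LinearMap.comp_assoc]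
      _ = idef (pull (liftMap (kingPr L kk r (cvM d L mv kk hL)) ι)) (pull (liftMap (kingPr L kk r (cvM d L mv kk hL)) ι)) (mulOp (fun p : ScX' d L mv kk r hL × ι => scPsi' d L mv kk r hL k p.1) ∘ₗ (scNV' d L mv kk r hL (aK a₀ (L : ℝ) (r + kk) * (((L ^ r * L ^ kk : ℕ) : ℝ)) ^ (d + 1)) ι e u' U' k) ∘ₗ mulOp (fun p : ScX' d L mv kk r hL × ι => scChi' d L mv kk r hL k p.1)) (mulOp (fun p : ScX d L mv kk hL × ι => scPsi d L mv kk hL k p.1) ∘ₗ (scNV d L mv kk hL (aK a₀ (L : ℝ) kk * (((L ^ kk : ℕ) : ℝ)) ^ (d + 1)) ι e (fun k x => u' k (kingSec (cvM d L mv kk hL) L kk r x)) U k) ∘ₗ mulOp (fun p : ScX d L mv kk hL × ι => scChi d L mv kk hL k p.1)) ∘ₗ mulOp (fun p : ScX d L mv kk hL × ι => scH d L mv kk hL k p.1) := by rw [s1, s2]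
  have hDeq : idef (pull (liftMap (kingPr L kk r (cvM d L mv kk hL)) ι)) (pull (liftMap (kingPr L kk r (cvM d L mv kk hL)) ι)) (mulOp (fun p : ScX' d L mv kk r hL × ι => scPsi' d L mv kk r hL k p.1) ∘ₗ (scP' d L mv kk r hL (aK a₀ (L : ℝ) (r + kk) * (((L ^ r * L ^ kk : ℕ) : ℝ)) ^ (d + 1)) ι e (scGaugeU' d L mv kk r hL (u' k) U') ∘ₗ mulOp (fun p : ScX' d L mv kk r hL × ι => scH' d L mv kk r hL k p.1))) (mulOp (fun p : ScX d L mv kk hL × ι => scPsi d L mv kk hL k p.1) ∘ₗ (scP d L mv kk hL (aK a₀ (L : ℝ) kk * (((L ^ kk : ℕ) : ℝ)) ^ (d + 1)) ι e (scGaugeU d L mv kk hL (fun x => u' k (kingSec (cvM d L mv kk hL) L kk r x)) U) ∘ₗ mulOp (fun p : ScX d L mv kk hL × ι => scH d L mv kk hL k p.1))) =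
      mulOp (fun p : ScX' d L mv kk r hL × ι => scPsi' d L mv kk r hL k p.1) ∘ₗ (scP' d L mv kk r hL (aK a₀ (L : ℝ) (r + kk) * (((L ^ r * L ^ kk : ℕ) : ℝ)) ^ (d + 1)) ι e (scGaugeU' d L mv kk r hL (u' k) U') ∘ₗ idef (pull (liftMap (kingPr L kk r (cvM d L mv kk hL)) ι)) (pull (liftMap (kingPr L kk r (cvM d L mv kk hL)) ι)) (mulOp (fun p : ScX' d L mv kk r hL × ι => scH' d L mv kk r hL k p.1)) (mulOp (fun p : ScX d L mv kk hL × ι => scH d L mv kk hL k p.1))) +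
        mulOp (fun p : ScX' d L mv kk r hL × ι => scPsi' d L mv kk r hL k p.1) ∘ₗ (idef (pull (liftMap (kingPr L kk r (cvM d L mv kk hL)) ι)) (pull (liftMap (kingPr L kk r (cvM d L mv kk hL)) ι)) (scQQ' d L mv kk r hL (aK a₀ (L : ℝ) (r + kk) * (((L ^ r * L ^ kk : ℕ) : ℝ)) ^ (d + 1)) ι) (scQQ d L mv kk hL (aK a₀ (L : ℝ) kk * (((L ^ kk : ℕ) : ℝ)) ^ (d + 1)) ι) ∘ₗ mulOp (fun p : ScX d L mv kk hL × ι => scH d L mv kk hL k p.1)) -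
        idef (pull (liftMap (kingPr L kk r (cvM d L mv kk hL)) ι)) (pull (liftMap (kingPr L kk r (cvM d L mv kk hL)) ι)) (mulOp (fun p : ScX' d L mv kk r hL × ι => scPsi' d L mv kk r hL k p.1) ∘ₗ (scNV' d L mv kk r hL (aK a₀ (L : ℝ) (r + kk) * (((L ^ r * L ^ kk : ℕ) : ℝ)) ^ (d + 1)) ι e u' U' k) ∘ₗ mulOp (fun p : ScX' d L mv kk r hL × ι => scChi' d L mv kk r hL k p.1)) (mulOp (fun p : ScX d L mv kk hL × ι => scPsi d L mv kk hL k p.1) ∘ₗ (scNV d L mv kk hL (aK a₀ (L : ℝ) kk * (((L ^ kk : ℕ) : ℝ)) ^ (d + 1)) ι e (fun k x => u' k (kingSec (cvM d L mv kk hL) L kk r x)) U k) ∘ₗ mulOp (fun p : ScX d L mv kk hL × ι => scChi d L mv kk hL k p.1)) ∘ₗ mulOp (fun p : ScX d L mv kk hL × ι => scH d L mv kk hL k p.1) := by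
    rw [idef_cut_comp (τ := pull (liftMap (kingPr L kk r (cvM d L mv kk hL)) ι)) (pr := liftMap (kingPr L kk r (cvM d L mv kk hL)) ι) (hχ := hψpull), idef_comp (pull (liftMap (kingPr L kk r (cvM d L mv kk hL)) ι)) (pull (liftMap (kingPr L kk r (cvM d L mv kk hL)) ι)) (pull (liftMap (kingPr L kk r (cvM d L mv kk hL)) ι)), hPid, ← eN]
    simp only [LinearMap.comp_add, LinearMap.comp_sub, LinearMap.sub_comp]
    abel
  -- (4a) the partition fit row
  have hT0 : (pull (liftMap (kingPr L kk r (cvM d L mv kk hL)) ι)) = mmulOp (fun x' : ScX' d L mv kk r hL => ((fun _ : ScX' d L mv kk r hL => (1 : Matrix ι ι ℝ)) x')ᵀ) ∘ₗ pull (liftMap (kingPr L kk r (cvM d L mv kk hL)) ι) := by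
    rw [show (fun x' : ScX' d L mv kk r hL => ((fun _ : ScX' d L mv kk r hL => (1 : Matrix ι ι ℝ)) x')ᵀ) = fun _ => (1 : Matrix ι ι ℝ) from funext fun _ => Matrix.transpose_one, mmulOp_one, LinearMap.id_comp]
  have hfit1 : ∀ p : ScX' d L mv kk r hL × ι, |(fun p : ScX' d L mv kk r hL × ι => scH' d L mv kk r hL k p.1) p - (fun p : ScX d L mv kk hL × ι => scH d L mv kk hL k p.1) (liftMap (kingPr L kk r (cvM d L mv kk hL)) ι p)| ≤ (Real.pi * (d + 1) / (((L ^ kk : ℕ) : ℝ) * ((L ^ mv : ℕ) : ℝ))) := fun p =>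
    abs_scH'_sub_scH_kingPr_le ι hM hw k p
  have hOHo0 : (0 : ℝ) ≤ (Real.pi * (d + 1) / (((L ^ kk : ℕ) : ℝ) * ((L ^ mv : ℕ) : ℝ))) := by positivity
  have hDh := hasMaj_idef_mulOp_tr (g := unitTorusGeo L kk (cvM d L mv kk hL)) (scBlk d L mv kk hL) (kingPr L kk r (cvM d L mv kk hL)) (pull (liftMap (kingPr L kk r (cvM d L mv kk hL)) ι)) hT0 (fun x' i j => by
      rw [Matrix.transpose_one, Matrix.one_apply]; split_ifs <;> norm_num) hOHo0 hfit1
  have hc' : HasMaj (ScNorm d L mv kk hL ι) (BlockNorm.ofBlocks (unitTorusGeo L kk (cvM d L mv kk hL)) (liftBlk (scBlk d L mv kk hL ∘ kingPr L kk r (cvM d L mv kk hL)) ι)) (scP' d L mv kk r hL (aK a₀ (L : ℝ) (r + kk) * (((L ^ r * L ^ kk : ℕ) : ℝ)) ^ (d + 1)) ι e (scGaugeU' d L mv kk r hL (u' k) U') ∘ₗ idef (pull (liftMap (kingPr L kk r (cvM d L mv kk hL)) ι)) (pull (liftMap (kingPr L kk r (cvM d L mv kk hL)) ι)) (mulOp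 (fun p : ScX' d L mv kk r hL × ι => scH' d L mv kk r hL k p.1)) (mulOp (fun p : ScX d L mv kk hL × ι => scH d L mv kk hL k p.1))) (fun y y' => (a₀ * (Fintype.card ι : ℝ) ^ 2 * (Fintype.card ι * (Real.pi * (d + 1) / (((L ^ kk : ℕ) : ℝ) * ((L ^ mv : ℕ) : ℝ))))) * Real.exp (-(δ * (unitTorusGeo L kk (cvM d L mv kk hL)).dist y y'))) := by
    have hc := B11SectG.hasMaj_comp hPV'row hDh hEXP0
    refine hc.mono fun y y' => ?_
    have hκ1 : (BlockNorm.ofBlocks (unitTorusGeo L kk (cvM d L mv kk hL)) (liftBlk (scBlk d L mv kk hL ∘ kingPr L kk r (cvM d L mv kk hL)) ι)).κ = 1 := rfl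
    rw [hκ1, Finset.sum_eq_single y' (fun y'' _ hne => by rw [diagK_ne _ hne]; ring) (fun h => absurd (Finset.mem_univ y') h), diagK_same]
    have hE : Real.exp (-(δ * (unitTorusGeo L kk (cvM d L mv kk hL)).dist y y')) ≤ 1 := by
      rw [Real.exp_le_one_iff]; exact neg_nonpos.mpr (mul_nonneg hδ (Literature.MathematicalPhysics.QuantumFieldTheory.Balaban1983to89.B6UnitTorusCarrier.unitTorusGeo_dist_nonneg L kk (cvM d L mv kk hL) y y'))
    nlinarith only [hE, hι0, hOHo0, ha₀.le, Real.exp_nonneg (-(δ * (unitTorusGeo L kk (cvM d L mv kk hL)).dist y y')), sq_nonneg (Fintype.card ι : ℝ)]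
  have hD1 : HasMaj (ScNorm d L mv kk hL ι) (BlockNorm.ofBlocks (unitTorusGeo L kk (cvM d L mv kk hL)) (liftBlk (scBlk d L mv kk hL ∘ kingPr L kk r (cvM d L mv kk hL)) ι)) (mulOp (fun p : ScX' d L mv kk r hL × ι => scPsi' d L mv kk r hL k p.1) ∘ₗ (scP' d L mv kk r hL (aK a₀ (L : ℝ) (r + kk) * (((L ^ r * L ^ kk : ℕ) : ℝ)) ^ (d + 1)) ι e (scGaugeU' d L mv kk r hL (u' k) U') ∘ₗ idef (pull (liftMap (kingPr L kk r (cvM d L mv kk hL)) ι)) (pull (liftMap (kingPr L kk r (cvM d L mv kk hL)) ι)) (mulOp (fun p : ScX' d L mv kk r hL × ι => scH' d L mv kk r hL k p.1)) (mulOp (fun p : ScX d L mv kk hL × ι => scH d L mv kk hL k p.1))))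
      (fun y y' => (a₀ * (Fintype.card ι : ℝ) ^ 2 * (Fintype.card ι * (Real.pi * (d + 1) / (((L ^ kk : ℕ) : ℝ) * ((L ^ mv : ℕ) : ℝ))))) * Real.exp (-(δ * (unitTorusGeo L kk (cvM d L mv kk hL)).dist y y'))) :=
    hasMaj_mulOp_comp_of_abs_le_one (liftBlk (scBlk d L mv kk hL ∘ kingPr L kk r (cvM d L mv kk hL)) ι) (m := (fun p : ScX' d L mv kk r hL × ι => scPsi' d L mv kk r hL k p.1)) hψ1le (fun y y' => show (0 : ℝ) ≤ (a₀ * (Fintype.card ι : ℝ) ^ 2 * (Fintype.card ι * (Real.pi * (d + 1) / (((L ^ kk : ℕ) : ℝ) * ((L ^ mv : ℕ) : ℝ))))) * Real.exp (-(δ * (unitTorusGeo L kk (cvM d L mv kk hL)).dist y y')) from by positivity) hc'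
  -- (4b) the flat nonlocal row (a_K′ − a_K)
  have hQQ : HasMaj (ScNorm d L mv kk hL ι) (BlockNorm.ofBlocks (unitTorusGeo L kk (cvM d L mv kk hL)) (liftBlk (scBlk d L mv kk hL ∘ kingPr L kk r (cvM d L mv kk hL)) ι)) (idef (pull (liftMap (kingPr L kk r (cvM d L mv kk hL)) ι)) (pull (liftMap (kingPr L kk r (cvM d L mv kk hL)) ι)) (scQQ' d L mv kk r hL (aK a₀ (L : ℝ) (r + kk) * (((L ^ r * L ^ kk : ℕ) : ℝ)) ^ (d + 1)) ι) (scQQ d L mv kk hL (aK a₀ (L : ℝ) kk * (((L ^ kk : ℕ) : ℝ)) ^ (d + 1)) ι)) (fun y y' => (4 / 3 * a₀ * ((L : ℝ) ^ kk) ^ (-(2 : ℝ))) * Real.exp (-(δ * (unitTorusGeo L kk (cvM d L mv kk hL)).dist y y'))) :=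
    hasMaj_idef_pull_scQQ_king (d := d) (mv := mv) (r := r) (hL := hL) ι hL2 hkk ha₀ (γ := 2) le_rfl δ
  have hD2 : HasMaj (ScNorm d L mv kk hL ι) (BlockNorm.ofBlocks (unitTorusGeo L kk (cvM d L mv kk hL)) (liftBlk (scBlk d L mv kk hL ∘ kingPr L kk r (cvM d L mv kk hL)) ι)) (mulOp (fun p : ScX' d L mv kk r hL × ι => scPsi' d L mv kk r hL k p.1) ∘ₗ (idef (pull (liftMap (kingPr L kk r (cvM d L mv kk hL)) ι)) (pull (liftMap (kingPr L kk r (cvM d L mv kk hL)) ι)) (scQQ' d L mv kk r hL (aK a₀ (L : ℝ) (r + kk) * (((L ^ r * L ^ kk : ℕ) : ℝ)) ^ (d + 1)) ι) (scQQ d L mv kk hL (aK a₀ (L : ℝ) kk * (((L ^ kk : ℕ) : ℝ)) ^ (d + 1)) ι) ∘ₗ mulOp (fun p : ScX d L mv kk hL × ι => scH d L mv kk hL k p.1))) (fun y y' => (4 / 3 * a₀ * ((L : ℝ) ^ kk) ^ (-(2 : ℝ))) * Real.exp (-(δ * (unitTorusGeo L kk (cvM d L mv kk hL)).dist y y')))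 := by
    have h1 := hasMaj_comp_mulOp_cut (b₂ := BlockNorm.ofBlocks (unitTorusGeo L kk (cvM d L mv kk hL)) (liftBlk (scBlk d L mv kk hL ∘ kingPr L kk r (cvM d L mv kk hL)) ι)) (liftBlk (scBlk d L mv kk hL) ι) (fun y y' => by positivity) (χ := (fun p : ScX d L mv kk hL × ι => scH d L mv kk hL k p.1)) (S := (Set.univ : Set (Tor (cvM d L mv kk hL)))) hhle (fun _ _ => Set.mem_univ _) hQQ
    have h2 := hasMaj_mulOp_comp_of_abs_le_one (liftBlk (scBlk d L mv kk hL ∘ kingPr L kk r (cvM d L mv kk hL)) ι) (m := (fun p : ScX' d L mv kk r hL × ι => scPsi' d L mv kk r hL k p.1)) hψ1le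
      (fun y y' => show (0 : ℝ) ≤ ind (g := unitTorusGeo L kk (cvM d L mv kk hL)) (Set.univ : Set (Tor (cvM d L mv kk hL))) y' * ((4 / 3 * a₀ * ((L : ℝ) ^ kk) ^ (-(2 : ℝ))) * Real.exp (-(δ * (unitTorusGeo L kk (cvM d L mv kk hL)).dist y y'))) from mul_nonneg (ind_nonneg (g := unitTorusGeo L kk (cvM d L mv kk hL)) Set.univ y') (by positivity)) h1
    exact h2.mono fun y y' => by rw [hind, one_mul]
  -- (4c) 352's cut Gram row through the partition
  have hNV := hasMaj_idef_scNV_pairing (d := d) ι e he a₀ u' hu' U' hU' U hpair hρ hb hρk hbk δ k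
  have hD3 : HasMaj (ScNorm d L mv kk hL ι) (BlockNorm.ofBlocks (unitTorusGeo L kk (cvM d L mv kk hL)) (liftBlk (scBlk d L mv kk hL ∘ kingPr L kk r (cvM d L mv kk hL)) ι)) (idef (pull (liftMap (kingPr L kk r (cvM d L mv kk hL)) ι)) (pull (liftMap (kingPr L kk r (cvM d L mv kk hL)) ι)) (mulOp (fun p : ScX' d L mv kk r hL × ι => scPsi' d L mv kk r hL k p.1) ∘ₗ (scNV' d L mv kk r hL (aK a₀ (L : ℝ) (r + kk) * (((L ^ r * L ^ kk : ℕ) : ℝ)) ^ (d + 1)) ι e u' U' k) ∘ₗ mulOp (fun p : ScX' d L mv kk r hL × ι => scChi' d L mv kk r hL k p.1)) (mulOp (fun p : ScX d L mv kk hL × ι => scPsi d L mv kk hL k p.1) ∘ₗ (scNV d L mv kk hL (aK a₀ (L : ℝ) kk * (((L ^ kk : ℕ) : ℝ)) ^ (d + 1)) ι e (fun k x => u' k (kingSec (cvM d L mv kk hL) L kk r x)) U k) ∘ₗ mulOp (fun p : ScX d L mv kk hL × ι => scChi d L mv kk hL k p.1)) ∘ₗ mulOp (fun p : ScX d L mv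 kk hL × ι => scH d L mv kk hL k p.1)) (fun y y' => (Fintype.card ι * (|aK a₀ (L : ℝ) (r + kk) - aK a₀ (L : ℝ) kk| * (1 + Fintype.card ι) + |aK a₀ (L : ℝ) kk| * (2 * Fintype.card ι * (@basisConst ι _ (Matrix mm mm ℂ) Matrix.frobeniusNormedAddCommGroup Matrix.frobeniusNormedSpace e * (2 * Real.sqrt (Fintype.card mm)) * (Real.sqrt (Fintype.card mm) * ((d + 1) * (d * ((((L ^ r * L ^ kk : ℕ) : ℝ)) * (((L ^ r : ℕ) : ℝ) * b)) + ((1 + ρ) ^ (L ^ r) - 1)))))))) * Real.exp (-(δ * (unitTorusGeo L kk (cvM d L mv kk hL)).dist y y'))) := by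
    have h1 := hasMaj_comp_mulOp_cut (b₂ := BlockNorm.ofBlocks (unitTorusGeo L kk (cvM d L mv kk hL)) (liftBlk (scBlk d L mv kk hL ∘ kingPr L kk r (cvM d L mv kk hL)) ι)) (liftBlk (scBlk d L mv kk hL) ι) (fun y y' => by
      have : (0 : ℝ) ≤ (1 + ρ) ^ (L ^ r) - 1 := by have := one_le_pow₀ (M₀ := ℝ) (a := 1 + ρ) (le_add_of_nonneg_right hρ) (n := L ^ r); linarith
      positivity) (χ := (fun p : ScX d L mv kk hL × ι => scH d L mv kk hL k p.1)) (S := (Set.univ : Set (Tor (cvM d L mv kk hL)))) hhle (fun _ _ => Set.mem_univ _) hNV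
    exact h1.mono fun y y' => by rw [hind, one_mul]
  have hD : HasMaj (ScNorm d L mv kk hL ι) (BlockNorm.ofBlocks (unitTorusGeo L kk (cvM d L mv kk hL)) (liftBlk (scBlk d L mv kk hL ∘ kingPr L kk r (cvM d L mv kk hL)) ι)) (idef (pull (liftMap (kingPr L kk r (cvM d L mv kk hL)) ι)) (pull (liftMap (kingPr L kk r (cvM d L mv kk hL)) ι)) (mulOp (fun p : ScX' d L mv kk r hL × ι => scPsi' d L mv kk r hL k p.1) ∘ₗ (scP' d L mv kk r hL (aK a₀ (L : ℝ) (r + kk) * (((L ^ r * L ^ kk : ℕ) : ℝ)) ^ (d + 1)) ι e (scGaugeU' d L mv kk r hL (u' k) U') ∘ₗ mulOp (fun p : ScX' d L mv kk r hL × ι => scH' d L mv kk r hL k p.1))) (mulOp (fun p : ScX d L mv kk hL × ι => scPsi d L mv kk hL k p.1) ∘ₗ (scP d L mv kk hL (aK a₀ (L : ℝ) kk * (((L ^ kk : ℕ) : ℝ)) ^ (d + 1)) ι e (scGaugeU d L mv kk hL (fun x => u' k (kingSec (cvM d L mv kk hL) L kk r x)) U) ∘ₗ mulOp (fun p : ScX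 d L mv kk hL × ι => scH d L mv kk hL k p.1))))
      (fun y y' => ind (g := unitTorusGeo L kk (cvM d L mv kk hL)) (Set.univ : Set (Tor (cvM d L mv kk hL))) y * ind (g := unitTorusGeo L kk (cvM d L mv kk hL)) (Set.univ : Set (Tor (cvM d L mv kk hL))) y' * (((4 / 3 * a₀ * ((L : ℝ) ^ kk) ^ (-(2 : ℝ))) + (Fintype.card ι * (|aK a₀ (L : ℝ) (r + kk) - aK a₀ (L : ℝ) kk| * (1 + Fintype.card ι) + |aK a₀ (L : ℝ) kk| * (2 * Fintype.card ι * (@basisConst ι _ (Matrix mm mm ℂ) Matrix.frobeniusNormedAddCommGroup Matrix.frobeniusNormedSpace e * (2 * Real.sqrt (Fintype.card mm)) * (Real.sqrt (Fintype.card mm) * ((d + 1) * (d * ((((L ^ r * L ^ kk : ℕ) : ℝ)) * (((L ^ r : ℕ) : ℝ) * b)) + ((1 + ρ) ^ (L ^ r) - 1)))))))) + (a₀ * (Fintype.card ι : ℝ) ^ 2 * (Fintype.card ι * (Real.pi * (d + 1) / (((L ^ kk : ℕ) : ℝ) * ((L ^ mv : ℕ) : ℝ)))))) * Real.exp (-(δ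 * (unitTorusGeo L kk (cvM d L mv kk hL)).dist y y')))) := by
    rw [hDeq]
    refine ((hD1.add hD2).sub hD3).mono fun y y' => ?_
    rw [hind, hind]; ring_nf; exact le_rfl
  -- (5) dag-n15-w2's per-piece conversion (n15-c∕333)
  have key := cutDefect_of_localGauge_tr (g := unitTorusGeo L kk (cvM d L mv kk hL)) (scBlk d L mv kk hL) (kingPr L kk r (cvM d L mv kk hL)) (kingSec (cvM d L mv kk hL) L kk r) (fun _ => (Set.univ : Set (Tor (cvM d L mv kk hL)))) (ctauS (cvM d L mv kk hL) L kk r (cvT e U')) W' St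
    (G'' := fun _ => scP' d L mv kk r hL (aK a₀ (L : ℝ) (r + kk) * (((L ^ r * L ^ kk : ℕ) : ℝ)) ^ (d + 1)) ι e (scGaugeU' d L mv kk r hL (u' k) U') ∘ₗ mulOp (fun p : ScX' d L mv kk r hL × ι => scH' d L mv kk r hL k p.1)) (G' := fun _ => scP d L mv kk hL (aK a₀ (L : ℝ) kk * (((L ^ kk : ℕ) : ℝ)) ^ (d + 1)) ι e (scGaugeU d L mv kk hL (fun x => u' k (kingSec (cvM d L mv kk hL) L kk r x)) U) ∘ₗ mulOp (fun p : ScX d L mv kk hL × ι => scH d L mv kk hL k p.1))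
    (χX' := fun k (x' : ScX' d L mv kk r hL) => scPsi' d L mv kk r hL k x') (χX := fun k (x : ScX d L mv kk hL) => scPsi d L mv kk hL k x)
    (ψin' := fun k (x' : ScX' d L mv kk r hL) => scChi' d L mv kk r hL k x') (ψout := fun k (x : ScX d L mv kk hL) => scPsi d L mv kk hL k x)
    hW'1 hW'2 hβ0 hm0 hs0 k hTk hGin' hGout hSin hSout hGc hGc' hD
  -- (6) back to the raw pieces: `M_W′ᵀ(P′(V′)M_h′)M_W′ = P′(U′)M_h′` (gauge covariance of the summand)
  have hWW1 : mmulOp (fun x' : ScX' d L mv kk r hL => (coordMat e (ContinuousLinearMap.mulLeftRight ℝ (Matrix mm mm ℂ) (u' k x') (u' k x')ᴴ))ᵀ) ∘ₗ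
      mmulOp (fun x' : ScX' d L mv kk r hL => coordMat e (ContinuousLinearMap.mulLeftRight ℝ (Matrix mm mm ℂ) (u' k x') (u' k x')ᴴ)) = LinearMap.id := by
    rw [mmulOp_comp_mmulOp, show (fun x' : ScX' d L mv kk r hL => (coordMat e (ContinuousLinearMap.mulLeftRight ℝ (Matrix mm mm ℂ) (u' k x') (u' k x')ᴴ))ᵀ * coordMat e (ContinuousLinearMap.mulLeftRight ℝ (Matrix mm mm ℂ) (u' k x') (u' k x')ᴴ)) = fun _ => 1 from
      funext fun x' => hW'1 k x', mmulOp_one]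
  have hWW0 : mmulOp (fun x : ScX d L mv kk hL => (coordMat e (ContinuousLinearMap.mulLeftRight ℝ (Matrix mm mm ℂ) (u' k (kingSec (cvM d L mv kk hL) L kk r x)) (u' k (kingSec (cvM d L mv kk hL) L kk r x))ᴴ))ᵀ) ∘ₗ
      mmulOp (fun x : ScX d L mv kk hL => coordMat e (ContinuousLinearMap.mulLeftRight ℝ (Matrix mm mm ℂ) (u' k (kingSec (cvM d L mv kk hL) L kk r x)) (u' k (kingSec (cvM d L mv kk hL) L kk r x))ᴴ)) = LinearMap.id := by
    rw [mmulOp_comp_mmulOp, show (fun x : ScX d L mv kk hL => (coordMat e (ContinuousLinearMap.mulLeftRight ℝ (Matrix mm mm ℂ) (u' k (kingSec (cvM d L mv kk hL) L kk r x)) (u' k (kingSec (cvM d L mv kk hL) L kk r x))ᴴ))ᵀ *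
      coordMat e (ContinuousLinearMap.mulLeftRight ℝ (Matrix mm mm ℂ) (u' k (kingSec (cvM d L mv kk hL) L kk r x)) (u' k (kingSec (cvM d L mv kk hL) L kk r x))ᴴ)) = fun _ => 1 from funext fun x => hW'1 k _, mmulOp_one]
  have hrawF : mmulOp (fun x' => (W' k x')ᵀ) ∘ₗ (scP' d L mv kk r hL (aK a₀ (L : ℝ) (r + kk) * (((L ^ r * L ^ kk : ℕ) : ℝ)) ^ (d + 1)) ι e (scGaugeU' d L mv kk r hL (u' k) U') ∘ₗ mulOp (fun p : ScX' d L mv kk r hL × ι => scH' d L mv kk r hL k p.1)) ∘ₗ mmulOp (W' k) = scP' d L mv kk r hL (aK a₀ (L : ℝ) (r + kk) * (((L ^ r * L ^ kk : ℕ) : ℝ)) ^ (d + 1)) ι e U' ∘ₗ mulOp (fun p : ScX' d L mv kk r hL × ι => scH' d L mv kk r hL k p.1) := by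
    simp only [hW'def]
    rw [← scP'_gauge (d := d) ι e he (aK a₀ (L : ℝ) (r + kk) * (((L ^ r * L ^ kk : ℕ) : ℝ)) ^ (d + 1)) (hu' k) U']
    have ec : mulOp (fun p : ScX' d L mv kk r hL × ι => scH' d L mv kk r hL k p.1) ∘ₗ mmulOp (fun x' : ScX' d L mv kk r hL => coordMat e (ContinuousLinearMap.mulLeftRight ℝ (Matrix mm mm ℂ) (u' k x') (u' k x')ᴴ)) =
        mmulOp (fun x' : ScX' d L mv kk r hL => coordMat e (ContinuousLinearMap.mulLeftRight ℝ (Matrix mm mm ℂ) (u' k x') (u' k x')ᴴ)) ∘ₗ mulOp (fun p : ScX' d L mv kk r hL × ι => scH' d L mv kk r hL k p.1) := by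
      rw [mulOp_fst_comp_mmulOp_smul, mmulOp_comp_mulOp_fst_smul]
    simp only [LinearMap.comp_assoc]
    rw [ec, ← LinearMap.comp_assoc (mulOp (fun p : ScX' d L mv kk r hL × ι => scH' d L mv kk r hL k p.1)) (mmulOp (fun x' : ScX' d L mv kk r hL => coordMat e (ContinuousLinearMap.mulLeftRight ℝ (Matrix mm mm ℂ) (u' k x') (u' k x')ᴴ)))
      (mmulOp (fun x' : ScX' d L mv kk r hL => (coordMat e (ContinuousLinearMap.mulLeftRight ℝ (Matrix mm mm ℂ) (u' k x') (u' k x')ᴴ))ᵀ)), hWW1, LinearMap.id_comp,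
      ← LinearMap.comp_assoc (scP' d L mv kk r hL (aK a₀ (L : ℝ) (r + kk) * (((L ^ r * L ^ kk : ℕ) : ℝ)) ^ (d + 1)) ι e U' ∘ₗ mulOp (fun p : ScX' d L mv kk r hL × ι => scH' d L mv kk r hL k p.1)) (mmulOp (fun x' : ScX' d L mv kk r hL => coordMat e (ContinuousLinearMap.mulLeftRight ℝ (Matrix mm mm ℂ) (u' k x') (u' k x')ᴴ)))
      (mmulOp (fun x' : ScX' d L mv kk r hL => (coordMat e (ContinuousLinearMap.mulLeftRight ℝ (Matrix mm mm ℂ) (u' k x') (u' k x')ᴴ))ᵀ)), hWW1, LinearMap.id_comp]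
  have hrawC : mmulOp (fun x => (W' k (kingSec (cvM d L mv kk hL) L kk r x))ᵀ) ∘ₗ (scP d L mv kk hL (aK a₀ (L : ℝ) kk * (((L ^ kk : ℕ) : ℝ)) ^ (d + 1)) ι e (scGaugeU d L mv kk hL (fun x => u' k (kingSec (cvM d L mv kk hL) L kk r x)) U) ∘ₗ mulOp (fun p : ScX d L mv kk hL × ι => scH d L mv kk hL k p.1)) ∘ₗ mmulOp (fun x => W' k (kingSec (cvM d L mv kk hL) L kk r x)) = scP d L mv kk hL (aK a₀ (L : ℝ) kk * (((L ^ kk : ℕ) : ℝ)) ^ (d + 1)) ι e U ∘ₗ mulOp (fun p : ScX d L mv kk hL × ι => scH d L mv kk hL k p.1) := by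
    simp only [hW'def]
    rw [← scP_gauge (d := d) ι e he (aK a₀ (L : ℝ) kk * (((L ^ kk : ℕ) : ℝ)) ^ (d + 1)) (w := fun x => u' k (kingSec (cvM d L mv kk hL) L kk r x)) (fun x => hu' k _) U]
    have ec : mulOp (fun p : ScX d L mv kk hL × ι => scH d L mv kk hL k p.1) ∘ₗ mmulOp (fun x : ScX d L mv kk hL => coordMat e (ContinuousLinearMap.mulLeftRight ℝ (Matrix mm mm ℂ) (u' k (kingSec (cvM d L mv kk hL) L kk r x)) (u' k (kingSec (cvM d L mv kk hL) L kk r x))ᴴ)) =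
        mmulOp (fun x : ScX d L mv kk hL => coordMat e (ContinuousLinearMap.mulLeftRight ℝ (Matrix mm mm ℂ) (u' k (kingSec (cvM d L mv kk hL) L kk r x)) (u' k (kingSec (cvM d L mv kk hL) L kk r x))ᴴ)) ∘ₗ mulOp (fun p : ScX d L mv kk hL × ι => scH d L mv kk hL k p.1) := by
      rw [mulOp_fst_comp_mmulOp_smul, mmulOp_comp_mulOp_fst_smul]
    simp only [LinearMap.comp_assoc]
    rw [ec, ← LinearMap.comp_assoc (mulOp (fun p : ScX d L mv kk hL × ι => scH d L mv kk hL k p.1)) (mmulOp (fun x : ScX d L mv kk hL => coordMat e (ContinuousLinearMap.mulLeftRight ℝ (Matrix mm mm ℂ) (u' k (kingSec (cvM d L mv kk hL) L kk r x)) (u' k (kingSec (cvM d L mv kk hL) L kk r x))ᴴ)))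
      (mmulOp (fun x : ScX d L mv kk hL => (coordMat e (ContinuousLinearMap.mulLeftRight ℝ (Matrix mm mm ℂ) (u' k (kingSec (cvM d L mv kk hL) L kk r x)) (u' k (kingSec (cvM d L mv kk hL) L kk r x))ᴴ))ᵀ)), hWW0, LinearMap.id_comp,
      ← LinearMap.comp_assoc (scP d L mv kk hL (aK a₀ (L : ℝ) kk * (((L ^ kk : ℕ) : ℝ)) ^ (d + 1)) ι e U ∘ₗ mulOp (fun p : ScX d L mv kk hL × ι => scH d L mv kk hL k p.1)) (mmulOp (fun x : ScX d L mv kk hL => coordMat e (ContinuousLinearMap.mulLeftRight ℝ (Matrix mm mm ℂ) (u' k (kingSec (cvM d L mv kk hL) L kk r x)) (u' k (kingSec (cvM d L mv kk hL) L kk r x))ᴴ)))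
      (mmulOp (fun x : ScX d L mv kk hL => (coordMat e (ContinuousLinearMap.mulLeftRight ℝ (Matrix mm mm ℂ) (u' k (kingSec (cvM d L mv kk hL) L kk r x)) (u' k (kingSec (cvM d L mv kk hL) L kk r x))ᴴ))ᵀ)), hWW0, LinearMap.id_comp]
  rw [← hrawF, ← hrawC]
  refine key.mono fun y y' => ?_
  rw [hind, hind, one_mul, one_mul]

end Summit.QuantumFields.YangMills.BalabanUVNodes.N15.Gluing

end
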